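import Summits.NavierStokesRegularity.FunctionalMining.StretchingLaminateBurkholderTree
import Summits.NavierStokesRegularity.FunctionalMining.StretchingLaminateBurkholderCertE
import Summits.NavierStokesRegularity.FunctionalMining.StretchingLaminateEigen
import Mathlib.Analysis.Complex.ExponentialBounds
import Mathlib.Tactic.Linarith
import Mathlib.Tactic.FieldSimp
import HarnessLib

/-!
# FunctionalMining — K1-Q1 laminates, L-CAP-B kernel port (6): reduction to the pointwise claim, chord, numerics, finishing lemmas

search for candidate a priori estimates; no regularity claim.

Cell `pub-nsfunc` (host summit NavierStokesRegularity, topic `FunctionalMining`), prove seat gen 7.  Part of the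
kernel port of the bank seat's THEOREM L-CAP-B (`HOME/pub-nsfunc-bank/K1Q1-LAMINATE-BURKHOLDER.md` §1–§3, §7–§8; dict typing
notes 134/134a): `Burkholder1991_keyFunction → C_lam ≤ 49/50`, a cap on the laminate METHOD for the stretching constant
(`C_lam = laminateSupConst`), CONDITIONAL on the vendored Literature named fact `Burkholder1991_keyFunction` (Burkholder 1991,
LNM 1464, §8: the key function `u_λ` of Thm 8.1; only its CONCAVITY clause is used, always as an explicit hypothesis `hBK`).
Nothing in this file is a statement about Navier–Stokes solutions, and `C⋆ = stretchingSupConst` is not touched.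

THIS FILE — (i) the CHORD inequality `(1−r)·u_λ(0,z) + r·u_λ(1,z) ≤ u_λ(r,z)` (`chord_ineq`: the concavity clause with
`k = 0` along a radius of `E6`); (ii) the reduction of the typed leaf node `LeafClaimB` to a pointwise claim in
`(m, q, s) = (|ω|², |S|², s₁(S))` at unit ceiling (`leafClaimB_of_point`: eigenframe reduction `sym3_reduce` of (aq), ordering
of the eigenvalues — `p ≤ m·s₁`, `tr S³ = (3/2)s₁(2s₁² − q)`, `q ≤ 6s₁²`, `3s₁² ≤ 2q` — and homogeneity in `M`); (iii) the
numerical enclosures `ᾱ_{n+2} = 1/(4eⁿ)` from Mathlib's nine digits of `e` (`abar_nat_bounds`, `ksum_bounds`: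
`K = Σ c_k ᾱ_{λ_k} ∈ [38607/5000000, 15443/2000000]` for the design weights); (iv) the two FINISHING LEMMAS of the leaf
certificate at `(r, z, s)` for the design `θ = 49/50, a = −1131/2500, b = 103/500, c = 1/250000, λ = (8,11,17,23),
c = (49/5, 266/5, 93, 303/5)`: `caseA_finish` (`B ≥ 0`: faces by the chord and `Br² ≤ Br`, given the face bounds) and
`caseB_finish` (`s < 131/500`: exact near-origin forms `u = ᾱ(1+z²−r²)` on `D₀`, tangent minorant on `D₁`, sextic terms
dropped, certificates `e0/e1/e2` of `…CertE`).  The case analysis over `z` is in `…BurkholderCaseA1/2`, the cap in `…BurkholderCap`.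
-/

noncomputable section

namespace Summit.NavierStokesRegularity.FunctionalMining

namespace Laminate

open Burk Literature.Probability.Process Finset

/-! ## The chord inequality from the concavity clause (k = 0) -/

/-- **Chord inequality** (clause 2 of the Burkholder named fact with `k = 0`, along a radius): for `0 ≤ r ≤ 1`, `z ≥ 0`,
`(1 − r)·u_λ(0, z) + r·u_λ(1, z) ≤ u_λ(r, z)` — `u_λ(·, z)` lies above the chord from the centre to the sphere.
[ours; conditional on `Burkholder1991_keyFunction`] -/
theorem chord_ineq (hBK : Burkholder1991_keyFunction) {lam : ℝ} (hlam : 2 < lam) {r z : ℝ} (hr0 : 0 ≤ r)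
    (hr1 : r ≤ 1) (hz : 0 ≤ z) : (1 - r) * uProf lam 0 z + r * uProf lam 1 z ≤ uProf lam r z := by
  obtain ⟨h, hh⟩ : ∃ h : E6, h = WithLp.toLp 2 ![(1 : ℝ), 0, 0, 0, 0, 0] := ⟨_, rfl⟩
  obtain ⟨y, hy⟩ : ∃ y : E6, y = WithLp.toLp 2 ![(0 : ℝ), z, 0, 0, 0, 0] := ⟨_, rfl⟩
  have nh : ‖h‖ = 1 := by
    have h2 : ‖h‖ ^ 2 = 1 := by
      rw [EuclideanSpace.real_norm_sq_eq, hh]; simp [Fin.sum_univ_succ]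
    have h0 : 0 ≤ ‖h‖ := norm_nonneg _
    nlinarith [h2, h0]
  have ny : ‖y‖ = z := by
    have h2 : ‖y‖ ^ 2 = z ^ 2 := by
      rw [EuclideanSpace.real_norm_sq_eq, hy]; simp [Fin.sum_univ_succ]
    have h0 : 0 ≤ ‖y‖ := norm_nonneg _
    exact (sq_eq_sq₀ h0 hz).1 h2
  have hc := burk_concaveOn hBK hlam (0 : E6) y h (0 : E6) (by simp) (by simp [nh]) (by simp [nh])
  have h0 : (0 : ℝ) ∈ {t : ℝ | ‖(0 : E6) + t • h‖ ≤ 1} := by simp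
  have h1 : (1 : ℝ) ∈ {t : ℝ | ‖(0 : E6) + t • h‖ ≤ 1} := by simp [nh]
  have key := hc.2 h0 h1 (show (0 : ℝ) ≤ 1 - r by linarith) hr0 (by ring)
  simp only [smul_eq_mul, mul_zero, mul_one, zero_add, zero_smul, smul_zero, add_zero, one_smul] at key
  rw [burkholderU_eq_uProf, burkholderU_eq_uProf, burkholderU_eq_uProf, norm_zero, nh, ny, norm_smul, nh,
    mul_one, Real.norm_eq_abs, abs_of_nonneg hr0] at key
  exact key

/-! ## Reduction of `LeafClaimB` to the pointwise claim in `(m, q, s)` (eigenframe + homogeneity) -/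

/-- One ordered case (`d₂, d₃ ≤ d₁`) of the reduction: the point claim at `(m, q, s) = (V/M², Q/M², d₁/M)` gives the
homogeneous leaf inequality in eigen-coordinates. [ours; elementary] -/
theorem leafB_case {θ a b c : ℝ} {n : ℕ} {lam cs : Fin n → ℝ} (hb : 0 ≤ 1 - 3 / 4 * b)
    (hpt : ∀ m q s : ℝ, 0 ≤ m → m ≤ 1 → 0 ≤ q → 0 ≤ s → q ≤ 6 * s ^ 2 → 3 * s ^ 2 ≤ 2 * q →
      (1 - 3 / 4 * b) * m * s - θ * q - a * (q - m / 2) - (3 * b / 2) * s * (2 * s ^ 2 - q)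
        - c * (q ^ 3 + (10 * q ^ 2 + 450 * q + 1178) * (1 - m) - 1178)
        - ∑ k, cs k * (uProf (lam k) (Real.sqrt m) (Real.sqrt (2 * q)) - abar (lam k)) ≤ 0)
    (d1 d2 d3 v1 v2 v3 M V Q : ℝ) (hM : 0 < M) (hs : d1 + d2 + d3 = 0) (h2 : d2 ≤ d1) (h3 : d3 ≤ d1)
    (hV : V = v1 ^ 2 + v2 ^ 2 + v3 ^ 2) (hQ : Q = d1 ^ 2 + d2 ^ 2 + d3 ^ 2) (hm : V ≤ M ^ 2) :
    (1 - 3 / 4 * b) * (d1 * v1 ^ 2 + d2 * v2 ^ 2 + d3 * v3 ^ 2)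
      ≤ θ * M * Q + a * M * (Q - V / 2) + b * (d1 ^ 3 + d2 ^ 3 + d3 ^ 3)
        + c / M ^ 3 * (Q ^ 3 + (10 * Q ^ 2 + 450 * Q * M ^ 2 + 1178 * M ^ 4) * (M ^ 2 - V) - 1178 * M ^ 6)
        + M ^ 3 * ∑ k, cs k * (uProf (lam k) (Real.sqrt V / M) (Real.sqrt (2 * Q) / M) - abar (lam k)) := by
  have hM0 : M ≠ 0 := hM.ne'
  have hd3 : d3 = -d1 - d2 := by linarith
  have hd1 : 0 ≤ d1 := by linarith
  have hV0 : 0 ≤ V := by rw [hV]; positivity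
  have hQ0 : 0 ≤ Q := by rw [hQ]; positivity
  have hlo : Q ≤ 6 * d1 ^ 2 := by
    rw [hQ, hd3]; nlinarith [mul_nonneg (sub_nonneg.2 h2) (by linarith : 0 ≤ 2 * d1 + d2)]
  have hhi : 3 * d1 ^ 2 ≤ 2 * Q := by
    rw [hQ, hd3]; nlinarith [sq_nonneg (d1 + 2 * d2)]
  have hcube : d1 ^ 3 + d2 ^ 3 + d3 ^ 3 = 3 / 2 * d1 * (2 * d1 ^ 2 - Q) := by
    rw [hQ, hd3]; ring
  have hp : d1 * v1 ^ 2 + d2 * v2 ^ 2 + d3 * v3 ^ 2 ≤ V * d1 := by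
    rw [hV]
    nlinarith [mul_nonneg (sq_nonneg v2) (sub_nonneg.2 h2), mul_nonneg (sq_nonneg v3) (sub_nonneg.2 h3)]
  -- the point claim at the normalised variables
  have hsm : Real.sqrt (V / M ^ 2) = Real.sqrt V / M := by
    rw [Real.sqrt_div' _ (sq_nonneg M), Real.sqrt_sq hM.le]
  have hsq : Real.sqrt (2 * (Q / M ^ 2)) = Real.sqrt (2 * Q) / M := by
    rw [show 2 * (Q / M ^ 2) = 2 * Q / M ^ 2 by ring, Real.sqrt_div' _ (sq_nonneg M), Real.sqrt_sq hM.le]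
  have hM2 : 0 < M ^ 2 := by positivity
  have key := hpt (V / M ^ 2) (Q / M ^ 2) (d1 / M) (by positivity)
    (by rw [div_le_one hM2]; exact hm) (by positivity) (by positivity)
    (by
      have e1 : Q / M ^ 2 = (1 / M ^ 2) * Q := by ring
      have e2 : 6 * (d1 / M) ^ 2 = (1 / M ^ 2) * (6 * d1 ^ 2) := by ring
      rw [e1, e2]; exact mul_le_mul_of_nonneg_left hlo (by positivity))
    (by
      have e1 : 3 * (d1 / M) ^ 2 = (1 / M ^ 2) * (3 * d1 ^ 2) := by ring
      have e2 : 2 * (Q / M ^ 2) = (1 / M ^ 2) * (2 * Q) := by ring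
      rw [e1, e2]; exact mul_le_mul_of_nonneg_left hhi (by positivity))
  rw [hsm, hsq] at key
  set U := ∑ k, cs k * (uProf (lam k) (Real.sqrt V / M) (Real.sqrt (2 * Q) / M) - abar (lam k)) with hU
  -- multiply by `M³`
  have hM3 : 0 < M ^ 3 := pow_pos hM 3
  have key2 := mul_le_mul_of_nonneg_left key hM3.le
  rw [mul_zero] at key2
  have expand : M ^ 3 * ((1 - 3 / 4 * b) * (V / M ^ 2) * (d1 / M) - θ * (Q / M ^ 2) - a * (Q / M ^ 2 - V / M ^ 2 / 2)
      - 3 * b / 2 * (d1 / M) * (2 * (d1 / M) ^ 2 - Q / M ^ 2)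
      - c * ((Q / M ^ 2) ^ 3 + (10 * (Q / M ^ 2) ^ 2 + 450 * (Q / M ^ 2) + 1178) * (1 - V / M ^ 2) - 1178) - U)
      = (1 - 3 / 4 * b) * V * d1 - (θ * M * Q + a * M * (Q - V / 2) + b * (3 / 2 * d1 * (2 * d1 ^ 2 - Q))
        + c / M ^ 3 * (Q ^ 3 + (10 * Q ^ 2 + 450 * Q * M ^ 2 + 1178 * M ^ 4) * (M ^ 2 - V) - 1178 * M ^ 6)
        + M ^ 3 * U) := by
    field_simp
    ring
  rw [expand] at key2
  rw [hcube]
  nlinarith [mul_le_mul_of_nonneg_left hp hb]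

/-- **Reduction of the typed leaf node to the pointwise claim**: if the `(m, q, s)`-claim holds (`m = |ω|²`, `q = |S|²`,
`s = s₁(S)` the top eigenvalue, unit ceiling `M = 1`; `u`-terms through `uProf λ (√m) (√(2q))`), then `LeafClaimB` holds for
every `M > 0` (eigenframe reduction `sym3_reduce` of (aq), ordering of the eigenvalues, homogeneity). [ours; elementary] -/
theorem leafClaimB_of_point {θ a b c : ℝ} {n : ℕ} {lam cs : Fin n → ℝ} (hb : 0 ≤ 1 - 3 / 4 * b)
    (hpt : ∀ m q s : ℝ, 0 ≤ m → m ≤ 1 → 0 ≤ q → 0 ≤ s → q ≤ 6 * s ^ 2 → 3 * s ^ 2 ≤ 2 * q →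
      (1 - 3 / 4 * b) * m * s - θ * q - a * (q - m / 2) - (3 * b / 2) * s * (2 * s ^ 2 - q)
        - c * (q ^ 3 + (10 * q ^ 2 + 450 * q + 1178) * (1 - m) - 1178)
        - ∑ k, cs k * (uProf (lam k) (Real.sqrt m) (Real.sqrt (2 * q)) - abar (lam k)) ≤ 0) :
    LeafClaimB θ a b c lam cs := by
  intro G M hM htr hvort
  obtain ⟨d, v, h1, h2, h3, h4, h5⟩ := sym3_reduce (G.g00 : ℝ) (G.g11 : ℝ) (G.g22 : ℝ)
      (((G.g01 : ℝ) + (G.g10 : ℝ)) / 2) (((G.g02 : ℝ) + (G.g20 : ℝ)) / 2) (((G.g12 : ℝ) + (G.g21 : ℝ)) / 2)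
      (G.vort0 : ℝ) (G.vort1 : ℝ) (G.vort2 : ℝ)
  have htr' : G.g00 + G.g11 + G.g22 = 0 := htr
  have D0 : d 0 + d 1 + d 2 = 0 := by rw [h1]; exact_mod_cast htr'
  have hQ : ((G.sSq : ℚ) : ℝ) = d 0 ^ 2 + d 1 ^ 2 + d 2 ^ 2 := by
    rw [h2]; simp only [Grad.sSq]; push_cast; ring
  have C3 : ((G.symCubeTrace : ℚ) : ℝ) = d 0 ^ 3 + d 1 ^ 3 + d 2 ^ 3 := by
    rw [h3]; simp only [Grad.symCubeTrace]; push_cast; ring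
  have hVm : ((G.vortSq : ℚ) : ℝ) = v 0 ^ 2 + v 1 ^ 2 + v 2 ^ 2 := by
    rw [h4]; simp only [Grad.vortSq]; push_cast; ring
  have hP : ((G.stretch : ℚ) : ℝ) = d 0 * v 0 ^ 2 + d 1 * v 1 ^ 2 + d 2 * v 2 ^ 2 := by
    rw [h5]; simp only [Grad.stretch]; push_cast; ring
  have hv : v 0 ^ 2 + v 1 ^ 2 + v 2 ^ 2 ≤ M ^ 2 := by rw [← hVm]; exact hvort
  -- the `u`-terms through `V = |ω|²`, `Q = |S|²`
  have hU : ∀ k, burkNode (lam k) M G = uProf (lam k) (Real.sqrt (G.vortSq : ℝ) / M) (Real.sqrt (2 * (G.sSq : ℝ)) / M) :=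
    fun k => burkNode_eq_uProf hM G
  simp only [hU]
  rw [hP, C3]
  set V := ((G.vortSq : ℚ) : ℝ) with hVdef
  set Q := ((G.sSq : ℚ) : ℝ) with hQdef
  -- three cases for the top eigenvalue
  rcases le_total (d 1) (d 0) with h21 | h12
  · rcases le_total (d 2) (d 0) with h31 | h13
    · exact leafB_case hb hpt (d 0) (d 1) (d 2) (v 0) (v 1) (v 2) M V Q hM D0 h21 h31 hVm hQ hvort
    · have := leafB_case hb hpt (d 2) (d 0) (d 1) (v 2) (v 0) (v 1) M V Q hM (by linarith) h13 (by linarith)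
        (by rw [hVm]; ring) (by rw [hQ]; ring) (by linarith)
      linarith
  · rcases le_total (d 2) (d 1) with h32 | h23
    · have := leafB_case hb hpt (d 1) (d 2) (d 0) (v 1) (v 2) (v 0) M V Q hM (by linarith) h32 h12
        (by rw [hVm]; ring) (by rw [hQ]; ring) (by linarith)
      linarith
    · have := leafB_case hb hpt (d 2) (d 0) (d 1) (v 2) (v 0) (v 1) M V Q hM (by linarith) (by linarith) h23
        (by rw [hVm]; ring) (by rw [hQ]; ring) (by linarith)
      linarith


/-! ## Numerical enclosures of `ᾱ_λ = e^{2−λ}/4` at the four thresholds (from Mathlib's `e` to nine digits) -/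

/-- `ᾱ_{n+2} = 1/(4eⁿ)`. [ours; bookkeeping] -/
theorem abar_nat (n : ℕ) : abar ((n : ℝ) + 2) = 1 / (4 * Real.exp 1 ^ n) := by
  unfold abar burkholderAlpha
  rw [Real.exp_one_pow, show -((n : ℝ) + 2) = -(n : ℝ) + -2 by ring, Real.exp_add, Real.exp_neg, Real.exp_neg]
  have h2 : Real.exp 2 ≠ 0 := (Real.exp_pos 2).ne'
  have hn : Real.exp (n : ℝ) ≠ 0 := (Real.exp_pos _).ne'
  field_simp

/-- Upper and lower enclosure of `ᾱ_{n+2}` from `2.7182818283 < e < 2.7182818286`. [ours; bookkeeping] -/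
theorem abar_nat_bounds (n : ℕ) :
    1 / (4 * (2.7182818286 : ℝ) ^ n) ≤ abar ((n : ℝ) + 2) ∧ abar ((n : ℝ) + 2) ≤ 1 / (4 * (2.7182818283 : ℝ) ^ n) := by
  rw [abar_nat]
  have hl : (2.7182818283 : ℝ) ^ n ≤ Real.exp 1 ^ n := pow_le_pow_left₀ (by norm_num) Real.exp_one_gt_d9.le n
  have hu : Real.exp 1 ^ n ≤ (2.7182818286 : ℝ) ^ n := pow_le_pow_left₀ (Real.exp_pos 1).le Real.exp_one_lt_d9.le n
  have hp : 0 < (2.7182818283 : ℝ) ^ n := by positivity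
  constructor
  · exact div_le_div_of_nonneg_left (by norm_num) (by positivity) (by linarith)
  · exact div_le_div_of_nonneg_left (by norm_num) (by positivity) (by linarith)

/-- `ᾱ₈ ≤ 619689·10⁻⁹`. [ours; bookkeeping] -/
theorem abar8_le : abar 8 ≤ ((619689 : ℝ) / 1000000000) := by
  have h := (abar_nat_bounds 6).2; norm_num at h; exact h.trans (by norm_num)

/-- `ᾱ₁₁ ≤ 30853·10⁻⁹`. [ours; bookkeeping] -/
theorem abar11_le : abar 11 ≤ ((30853 : ℝ) / 1000000000) := by
  have h := (abar_nat_bounds 9).2; norm_num at h; exact h.trans (by norm_num)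

/-- `ᾱ₁₇ ≤ 77·10⁻⁹`. [ours; bookkeeping] -/
theorem abar17_le : abar 17 ≤ ((77 : ℝ) / 1000000000) := by
  have h := (abar_nat_bounds 15).2; norm_num at h; exact h.trans (by norm_num)

/-- `ᾱ₂₃ ≤ 10⁻⁹`. [ours; bookkeeping] -/
theorem abar23_le : abar 23 ≤ ((1 : ℝ) / 1000000000) := by
  have h := (abar_nat_bounds 21).2; norm_num at h; exact h.trans (by norm_num)

/-- **The enclosure `K⁻ ≤ K ≤ K⁺` of `K = Σ c_k ᾱ_{λ_k}`** for the design weights. [ours; bookkeeping] -/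
theorem ksum_bounds : ((38607 : ℝ) / 5000000) ≤ ((49 : ℝ) / 5) * abar (8 : ℝ) + ((266 : ℝ) / 5) * abar (11 : ℝ) + (93 : ℝ) * abar (17 : ℝ) + ((303 : ℝ) / 5) * abar (23 : ℝ) ∧ ((49 : ℝ) / 5) * abar (8 : ℝ) + ((266 : ℝ) / 5) * abar (11 : ℝ) + (93 : ℝ) * abar (17 : ℝ) + ((303 : ℝ) / 5) * abar (23 : ℝ) ≤ ((15443 : ℝ) / 2000000) := by
  have h6 := abar_nat_bounds 6; have h9 := abar_nat_bounds 9; have h15 := abar_nat_bounds 15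
  have h21 := abar_nat_bounds 21
  norm_num at h6 h9 h15 h21
  constructor
  · linarith [h6.1, h9.1, h15.1, h21.1]
  · linarith [h6.2, h9.2, h15.2, h21.2]

/-! ## The two finishing lemmas of the leaf certificate (case A: faces by the chord; case B: small strain) -/

/-- **Case A (`B ≥ 0`): the chord reduces the leaf inequality to its two faces.**  With `hΦ0`, `hΦ1` the face bounds at
`(z, s)` (supplied by the certificates of files `…CertF0/F1`), the full inequality at `(r, z, s)` follows from the chord
inequality for each threshold and `B r² ≤ B r`. [ours; conditional on the named fact through `chord_ineq`] -/
theorem caseA_finish (hBK : Burkholder1991_keyFunction) {r z s : ℝ} (hr0 : 0 ≤ r) (hr1 : r ≤ 1) (hz0 : 0 ≤ z)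
    (hB : 0 ≤ ((-13843 : ℝ) / 62500) + ((1691 : ℝ) / 2000) * s + ((9 : ℝ) / 10000) * z ^ 2 + ((1 : ℝ) / 100000) * z ^ 4)
    (hΦ0 : ((-309 : ℝ) / 500) * s ^ 3 + ((-2647 : ℝ) / 10000) * z ^ 2 + ((309 : ℝ) / 2000) * z ^ 2 * s + ((-1 : ℝ) / 100000) * z ^ 4 + ((-1 : ℝ) / 2000000) * z ^ 6 + (((49 : ℝ) / 5) * abar (8 : ℝ) + ((266 : ℝ) / 5) * abar (11 : ℝ) + (93 : ℝ) * abar (17 : ℝ) + ((303 : ℝ) / 5) * abar (23 : ℝ)) - (((49 : ℝ) / 5) * uProf (8 : ℝ) 0 z + ((266 : ℝ) / 5) * uProf (11 : ℝ) 0 z + (93 : ℝ) * uProf (17 : ℝ) 0 z + ((303 : ℝ) / 5) * uProf (23 : ℝ) 0 z) ≤ 0)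
    (hΦ1 : ((-309 : ℝ) / 500) * s ^ 3 + ((-2647 : ℝ) / 10000) * z ^ 2 + ((309 : ℝ) / 2000) * z ^ 2 * s + ((-1 : ℝ) / 100000) * z ^ 4 + ((-1 : ℝ) / 2000000) * z ^ 6 + (((-13843 : ℝ) / 62500) + ((1691 : ℝ) / 2000) * s + ((9 : ℝ) / 10000) * z ^ 2 + ((1 : ℝ) / 100000) * z ^ 4) + (((49 : ℝ) / 5) * abar (8 : ℝ) + ((266 : ℝ) / 5) * abar (11 : ℝ) + (93 : ℝ) * abar (17 : ℝ) + ((303 : ℝ) / 5) * abar (23 : ℝ)) - (((49 : ℝ) / 5) * uProf (8 : ℝ) 1 z + ((266 : ℝ) / 5) * uProf (11 : ℝ) 1 z + (93 : ℝ) * uProf (17 : ℝ) 1 z + ((303 : ℝ) / 5) * uProf (23 : ℝ) 1 z) ≤ 0) :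
    (1 - 3 / 4 * ((103 : ℝ) / 500)) * r ^ 2 * s - ((49 : ℝ) / 50) * (z ^ 2 / 2) - ((-1131 : ℝ) / 2500) * (z ^ 2 / 2 - r ^ 2 / 2) - (3 * ((103 : ℝ) / 500) / 2) * s * (2 * s ^ 2 - z ^ 2 / 2) - ((1 : ℝ) / 250000) * ((z ^ 2 / 2) ^ 3 + (10 * (z ^ 2 / 2) ^ 2 + 450 * (z ^ 2 / 2) + 1178) * (1 - r ^ 2) - 1178) - (((49 : ℝ) / 5) * (uProf (8 : ℝ) r z - abar (8 : ℝ)) + ((266 : ℝ) / 5) * (uProf (11 : ℝ) r z - abar (11 : ℝ)) + (93 : ℝ) * (uProf (17 : ℝ) r z - abar (17 : ℝ)) + ((303 : ℝ) / 5) * (uProf (23 : ℝ) r z - abar (23 : ℝ))) ≤ 0 := by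
  have c1 := chord_ineq hBK (by norm_num : (2:ℝ) < 8) hr0 hr1 hz0
  have c2 := chord_ineq hBK (by norm_num : (2:ℝ) < 11) hr0 hr1 hz0
  have c3 := chord_ineq hBK (by norm_num : (2:ℝ) < 17) hr0 hr1 hz0
  have c4 := chord_ineq hBK (by norm_num : (2:ℝ) < 23) hr0 hr1 hz0
  have hr2 : r ^ 2 ≤ r := by nlinarith
  have hBr : (((-13843 : ℝ) / 62500) + ((1691 : ℝ) / 2000) * s + ((9 : ℝ) / 10000) * z ^ 2 + ((1 : ℝ) / 100000) * z ^ 4) * r ^ 2 ≤ (((-13843 : ℝ) / 62500) + ((1691 : ℝ) / 2000) * s + ((9 : ℝ) / 10000) * z ^ 2 + ((1 : ℝ) / 100000) * z ^ 4) * r := mul_le_mul_of_nonneg_left hr2 hB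
  have h1r : 0 ≤ 1 - r := by linarith
  have t0 := mul_nonpos_of_nonneg_of_nonpos h1r hΦ0
  have t1 := mul_nonpos_of_nonneg_of_nonpos hr0 hΦ1
  linarith [c1, c2, c3, c4, hBr, t0, t1]

/-- **Case B (`s < 131/500`, small strain): the exact near-origin forms of `u_λ`.**  On `D₀ = {r + z ≤ 1}`,
`u_{λ_k} = ᾱ_{λ_k}(1 + z² − r²)`; on `D₁ = {r + z ≥ 1}`, `u_{λ_k} ≥ 2ᾱ_{λ_k}(1−r)(r+z)`; the sextic terms are dropped
(`≤ 1178c·r²`), and the polynomial certificates `e0/e1/e2` close. [ours; elementary given the profile lemmas] -/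
theorem caseB_finish {r z s : ℝ} (hr0 : 0 ≤ r) (hr1 : r ≤ 1) (hz0 : 0 ≤ z) (hsB : s < ((131 : ℝ) / 500))
    (hsa : ((15 : ℝ) / 52) * z ≤ s) (hsb : s ≤ ((26 : ℝ) / 45) * z) : (1 - 3 / 4 * ((103 : ℝ) / 500)) * r ^ 2 * s - ((49 : ℝ) / 50) * (z ^ 2 / 2) - ((-1131 : ℝ) / 2500) * (z ^ 2 / 2 - r ^ 2 / 2) - (3 * ((103 : ℝ) / 500) / 2) * s * (2 * s ^ 2 - z ^ 2 / 2) - ((1 : ℝ) / 250000) * ((z ^ 2 / 2) ^ 3 + (10 * (z ^ 2 / 2) ^ 2 + 450 * (z ^ 2 / 2) + 1178) * (1 - r ^ 2) - 1178) - (((49 : ℝ) / 5) * (uProf (8 : ℝ) r z - abar (8 : ℝ)) + ((266 : ℝ) / 5) * (uProf (11 : ℝ) r z - abar (11 : ℝ)) + (93 : ℝ) * (uProf (17 : ℝ) r z - abar (17 : ℝ)) + ((303 : ℝ) / 5) * (uProf (23 : ℝ) r z - abar (23 : ℝ))) ≤ 0 := by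
  obtain ⟨K, hKdef⟩ : ∃ K : ℝ, K = ((49 : ℝ) / 5) * abar (8 : ℝ) + ((266 : ℝ) / 5) * abar (11 : ℝ) + (93 : ℝ) * abar (17 : ℝ) + ((303 : ℝ) / 5) * abar (23 : ℝ) := ⟨_, rfl⟩
  have hK := ksum_bounds
  rw [← hKdef] at hK
  have hzB : z ≤ ((1703 : ℝ) / 1875) := by linarith
  have hK1 : 0 ≤ K - ((38607 : ℝ) / 5000000) := by linarith [hK.1]
  have hK2 : 0 ≤ ((15443 : ℝ) / 2000000) - K := by linarith [hK.2]
  -- the dropped sextic terms are nonnegative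
  have hdrop : 0 ≤ ((1 : ℝ) / 250000) * ((z ^ 2 / 2) ^ 3 + (10 * (z ^ 2 / 2) ^ 2 + 450 * (z ^ 2 / 2)) * (1 - r ^ 2)) := by
    have : 0 ≤ 1 - r ^ 2 := by nlinarith
    positivity
  by_cases hD : r + z ≤ 1
  · -- D₀: exact forms
    have u1 := uProf_D0 (by norm_num : (2:ℝ) < 8) hr0 hr1 hz0 hD
    have u2 := uProf_D0 (by norm_num : (2:ℝ) < 11) hr0 hr1 hz0 hD
    have u3 := uProf_D0 (by norm_num : (2:ℝ) < 17) hr0 hr1 hz0 hD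
    have u4 := uProf_D0 (by norm_num : (2:ℝ) < 23) hr0 hr1 hz0 hD
    have hu : ((49 : ℝ) / 5) * uProf (8 : ℝ) r z + ((266 : ℝ) / 5) * uProf (11 : ℝ) r z + (93 : ℝ) * uProf (17 : ℝ) r z + ((303 : ℝ) / 5) * uProf (23 : ℝ) r z = K * (1 + z ^ 2 - r ^ 2) := by
      rw [u1, u2, u3, u4, hKdef]; ring
    have p0 := BurkCert.e0 z s hz0 (by linarith) (by linarith) (by linarith) (by linarith)
    have p1 := BurkCert.e1 z s K hz0 (by linarith) (by linarith) (by linarith) (by linarith) hK1 hK2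
    by_cases hsg : (((-13843 : ℝ) / 62500) + ((1691 : ℝ) / 2000) * s) + K ≤ 0
    · have t := mul_nonpos_of_nonpos_of_nonneg hsg (sq_nonneg r)
      have tz : 0 ≤ K * z ^ 2 := mul_nonneg (by linarith [hK.1]) (sq_nonneg z)
      linarith [p0, t, tz, hdrop, hu, hKdef]
    · have hpos : 0 ≤ (((-13843 : ℝ) / 62500) + ((1691 : ℝ) / 2000) * s) + K := le_of_lt (not_le.1 hsg)
      have hrz : r ^ 2 ≤ (1 - z) ^ 2 := by nlinarith
      have t := mul_le_mul_of_nonneg_left hrz hpos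
      linarith [p1, t, hdrop, hu, hKdef]
  · -- D₁: tangent minorant
    have hD' : 1 ≤ r + z := le_of_lt (not_le.1 hD)
    have u1 := uProf_D1_ge (by norm_num : (2:ℝ) < 8) hr0 hr1 hz0 hD' (by linarith)
    have u2 := uProf_D1_ge (by norm_num : (2:ℝ) < 11) hr0 hr1 hz0 hD' (by linarith)
    have u3 := uProf_D1_ge (by norm_num : (2:ℝ) < 17) hr0 hr1 hz0 hD' (by linarith)
    have u4 := uProf_D1_ge (by norm_num : (2:ℝ) < 23) hr0 hr1 hz0 hD' (by linarith)
    have hu : 2 * K * (1 - r) * (r + z) ≤ ((49 : ℝ) / 5) * uProf (8 : ℝ) r z + ((266 : ℝ) / 5) * uProf (11 : ℝ) r z + (93 : ℝ) * uProf (17 : ℝ) r z + ((303 : ℝ) / 5) * uProf (23 : ℝ) r z := by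
      rw [hKdef]; linarith [u1, u2, u3, u4]
    have p2 := BurkCert.e2 r z s K (by linarith) (by linarith) hz0 (by linarith) (by linarith) (by linarith)
      (by linarith) hK1 hK2
    linarith [p2, hu, hdrop, hKdef]

end Laminate

end Summit.NavierStokesRegularity.FunctionalMining

end
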